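import Literature.Probability.RandomPlanarGeometry.HexSAWSurfaceWallRenewalFourDownProfile
import Literature.Probability.RandomPlanarGeometry.HexSAWSurfaceWallRenewalSlackFourFourDownLeadingBump
import Literature.Probability.RandomPlanarGeometry.HexSAWSurfaceWallRenewalSlackFourFourDownHairpinBump
import Literature.Probability.RandomPlanarGeometry.HexSAWSurfaceWallRenewalSlackFourFourDownDipBump
import Literature.Probability.RandomPlanarGeometry.HexSAWSurfaceWallRenewalSlackFourFourDownTwoBumps
import Literature.Probability.RandomPlanarGeometry.HexSAWSurfaceWallRenewalSlackFourFourDownTripleDip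
import HarnessLib

/-!
# Slack four, four down steps: the five vertical orders

For the self-avoiding walk on the honeycomb lattice (brick-wall frame) in the half-plane `Y ≤ 0`, an IRREDUCIBLE POSITIVE
WALL BRIDGE `ω ∈ ipwb m` at SLACK FOUR (`m = 6k + 4`, `k = visits m ω ≥ 2`) has `2 ≤ #down ≤ 4` down steps
(`slack_four_counts` of `…IteratedGap`).  This module is the DISPATCHER of the stratum `#down = 4`:

* `four_down_slack_four` — the vertical profile of `profile_of_card_stepsD_eq_four` (`…FourDownProfile`: down times
  `p₁ < p₂ < p₃ < p₄`, up times `r₁ < r₂ < r₃ < r₄`, `pᵢ < rᵢ`, the initial wall run up to the first dive at the odd time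
  `p₁ ≥ 1`, all other steps horizontal) together with the ORDER ALTERNATIVE: the interleaving of the down and up times is
  one of the FIVE words
  `D D D D U U U U` (`p₄ < r₁`), `D D D U D U U U` (`p₃ < r₁ < p₄ < r₂`), `D D D U U D U U` (`p₃ < r₁`, `r₂ < p₄ < r₃`),
  `D D U D D U U U` (`p₂ < r₁ < p₃`, `p₄ < r₂`), `D D U U D D U U` (`p₂ < r₁`, `r₂ < p₃`, `p₄ < r₃`)
  — stated with exactly the order hypotheses of the run decompositions `dddduuuu4_runs`, `ddduduuu4_runs`,
  `ddduuduu4_runs`, `ddudduuu4_runs` (`…SlackFourFourDownRuns`) and `dduudduu4_runs` (`…SlackFourFourDownRunsReturn`).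
* `up_lt_down_four_down_slack_four` — corollary: if some up step precedes some down step, then `r₁ < p₄` and the word
  is one of the four crossing ones.

PROOF.  Of the fourteen interleavings with `pᵢ < rᵢ` (Dyck words of length eight) the nine others are excluded one by one:
the five words `D U …` by `leading_bump_four_down_slack_four_false` (`…SlackFourFourDownLeadingBump`, via the landing
law), `D D D U U U D U` by `ddduuudu_slack_four_false` (`…HairpinBump`), `D D U D U U D U` by `dduduudu_slack_four_false`
(`…DipBump`), `D D U U D U D U` by `dduududu_slack_four_false` (`…TwoBumps`) and `D D U D U D U U` by
`ddududuu_slack_four_false` (`…TripleDip`); the dispatcher is the decision tree over the comparisons `r₁ : p₂`,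
`r₁ : p₃`, `r₁ : p₄`, `r₂ : p₃`, `r₂ : p₄`, `r₃ : p₄` (a down time is never an up time: the vertical coordinate moves in
opposite directions, `of_mem_stepsD_coord` / `of_mem_stepsU_coord`).

STATUS: lane theorem of the a-idea-1 bridge/renewal lineage (car 94-G), closing the ORDER EXCLUSION for four down steps at
slack four (FINDING-HEX-WALL-SLACK-FOUR-LAW).  OURS (routine given the six exclusion modules): in the lane's enumeration of
all irreducible positive wall bridges at slack four for `k ≤ 8` the four-down walks (`0, 3, 27, 129, 424, 1105, 2463` at
`k = 2 … 8`) realise exactly these five words.  Four-down analogue of `three_down_slack_four` (`…SlackFourThreeDown`).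
The printed sources carry the renewal / irreducible-bridge structure (Madras–Slade §4.2, Definition 4.2.1, remark before
(4.2.21), p. 94) and the brickwork frame (Enting–Jensen §7.4.2, Fig. 7.10) — none states this classification.
No `set_option maxHeartbeats` line is used.
-/

namespace Literature.Probability.RandomPlanarGeometry.SAW.HexBW.Wall

open Finset Filter Function
open Literature.Probability.LatticeModels Literature.Probability.Percolation SimpleGraph

variable {ω : ℕ → Site 2}

/-- **Four down steps at slack four: the five orders.** For an irreducible positive wall bridge of length `m = 6k + 4`
(`k ≥ 2`) with `k` visits and exactly four down steps: the vertical profile of `profile_of_card_stepsD_eq_four` (down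
times `p₁ < p₂ < p₃ < p₄`, up times `r₁ < r₂ < r₃ < r₄`, `pᵢ < rᵢ`, initial wall run, first dive at the odd time `p₁ ≥ 1`,
all other steps horizontal), and the interleaving of the down and up times is one of `D D D D U U U U`, `D D D U D U U U`,
`D D D U U D U U`, `D D U D D U U U`, `D D U U D D U U` (order hypotheses as in `dddduuuu4_runs`, `ddduduuu4_runs`,
`ddduuduu4_runs`, `ddudduuu4_runs`, `dduudduu4_runs`).  OURS.
[cite: MadrasSlade1993, §4.2, Definition 4.2.1 (p. 90), remark before (4.2.21) (p. 94); EntingJensen2009, §7.4.2, Fig. 7.10] -/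
theorem four_down_slack_four {k m : ℕ} (hk : 2 ≤ k) (hm : m = 6 * k + 4) (hω : ω ∈ ipwb m) (hv : visits m ω = k)
    (hcD : #(stepsD m ω) = 4) :
    ∃ p₁ p₂ p₃ p₄ r₁ r₂ r₃ r₄, stepsD m ω = {p₁, p₂, p₃, p₄} ∧ stepsU m ω = {r₁, r₂, r₃, r₄} ∧ p₁ < p₂ ∧ p₂ < p₃ ∧
      p₃ < p₄ ∧ r₁ < r₂ ∧ r₂ < r₃ ∧ r₃ < r₄ ∧ p₁ < r₁ ∧ p₂ < r₂ ∧ p₃ < r₃ ∧ p₄ < r₄ ∧ 1 ≤ p₁ ∧ p₁ % 2 = 1 ∧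
      (∀ i, i ≤ p₁ → ω i 0 = i ∧ ω i 1 = 0) ∧ ω (p₁ + 1) 0 = p₁ ∧ ω (p₁ + 1) 1 = -1 ∧
      (∀ i, i < m → i ∉ stepsD m ω → i ∉ stepsU m ω →
        ω (i + 1) 1 = ω i 1 ∧ (ω (i + 1) 0 = ω i 0 + 1 ∨ ω (i + 1) 0 = ω i 0 - 1)) ∧
      (p₄ < r₁ ∨ (p₃ < r₁ ∧ r₁ < p₄ ∧ p₄ < r₂) ∨ (p₃ < r₁ ∧ r₂ < p₄ ∧ p₄ < r₃) ∨ (p₂ < r₁ ∧ r₁ < p₃ ∧ p₄ < r₂) ∨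
        (p₂ < r₁ ∧ r₂ < p₃ ∧ p₄ < r₃)) := by
  classical
  have hcU : #(stepsU m ω) = 4 := by rw [card_stepsU_eq_card_stepsD hω (by omega), hcD]
  obtain ⟨p₁, p₂, p₃, p₄, r₁, r₂, r₃, r₄, hD, hU, h12, h23, h34, hr12, hr23, hr34, h1, h2, h3, h4, hp1, hpodd, hR0, hP1x,
    hP1y, hhor, -⟩ := profile_of_card_stepsD_eq_four hω hcD hcU
  refine ⟨p₁, p₂, p₃, p₄, r₁, r₂, r₃, r₄, hD, hU, h12, h23, h34, hr12, hr23, hr34, h1, h2, h3, h4, hp1, hpodd, hR0, hP1x,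
    hP1y, hhor, ?_⟩
  -- a down time is never an up time: the vertical coordinate moves in opposite directions
  obtain ⟨hpw, -, -⟩ := mem_ipwb.1 hω
  obtain ⟨-, -, hbw, -⟩ := mem_saws_iff.1 (saws_of_mem_pwb hpw)
  have hne : ∀ p, p ∈ stepsD m ω → ∀ r, r ∈ stepsU m ω → p ≠ r := fun p hp r hr h => by
    obtain ⟨-, -, hpy, -⟩ := of_mem_stepsD_coord hbw hp
    obtain ⟨-, -, hry, -⟩ := of_mem_stepsU_coord hbw hr
    rw [h] at hpy
    omega
  have n21 := hne p₂ (by rw [hD]; simp) r₁ (by rw [hU]; simp)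
  have n31 := hne p₃ (by rw [hD]; simp) r₁ (by rw [hU]; simp)
  have n41 := hne p₄ (by rw [hD]; simp) r₁ (by rw [hU]; simp)
  have n32 := hne p₃ (by rw [hD]; simp) r₂ (by rw [hU]; simp)
  have n42 := hne p₄ (by rw [hD]; simp) r₂ (by rw [hU]; simp)
  have n43 := hne p₄ (by rw [hD]; simp) r₃ (by rw [hU]; simp)
  -- the decision tree
  rcases Nat.lt_or_gt_of_ne n21 with h21 | h21
  swap
  · -- `D U …`: a leading bump
    exact (leading_bump_four_down_slack_four_false hk hm hω hv hcD hD hU h12 h23 h34 hr12 hr23 hr34 h1 h2 hp1 hpodd hR0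
      hP1x hP1y hhor h21).elim
  rcases Nat.lt_or_gt_of_ne n31 with h31 | h31
  · -- `D D D …`
    rcases Nat.lt_or_gt_of_ne n41 with h41 | h41
    · exact Or.inl h41
    rcases Nat.lt_or_gt_of_ne n42 with h42 | h42
    · exact Or.inr (Or.inl ⟨h31, h41, h42⟩)
    rcases Nat.lt_or_gt_of_ne n43 with h43 | h43
    · exact Or.inr (Or.inr (Or.inl ⟨h31, h42, h43⟩))
    · -- `D D D U U U D U`: the deep hairpin followed by a bump
      exact (ddduuudu_slack_four_false hk hm hω hv hcD hD hU h12 h23 h34 hr12 hr23 hr34 h31 h43 h4 hp1 hR0 hP1x hP1y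
        hhor).elim
  · -- `D D U …`
    rcases Nat.lt_or_gt_of_ne n32 with h32 | h32
    · -- `D D U D …`
      rcases Nat.lt_or_gt_of_ne n42 with h42 | h42
      · exact Or.inr (Or.inr (Or.inr (Or.inl ⟨h21, h31, h42⟩)))
      rcases Nat.lt_or_gt_of_ne n43 with h43 | h43
      · -- `D D U D U D U U`: the triple dip
        exact (ddududuu_slack_four_false hk hm hω hv hcD hD hU h12 h23 h34 hr12 hr23 hr34 h21 h31 h32 h42 h43 hp1 hR0 hP1x
          hP1y hhor).elim
      · -- `D D U D U U D U`: the dipped hairpin followed by a bump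
        exact (dduduudu_slack_four_false hk hm hω hv hcD hD hU h12 h23 h34 hr12 hr23 hr34 h21 h31 h32 h43 h4 hp1 hR0 hP1x
          hP1y hhor).elim
    · -- `D D U U D …`
      rcases Nat.lt_or_gt_of_ne n43 with h43 | h43
      · exact Or.inr (Or.inr (Or.inr (Or.inr ⟨h21, h32, h43⟩)))
      · -- `D D U U D U D U`: the hairpin followed by two bumps
        exact (dduududu_slack_four_false hk hm hω hv hcD hD hU h12 h23 h34 hr12 hr23 hr34 h21 h32 h3 h43 h4 hp1 hR0 hP1x
          hP1y hhor).elim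

/-- **Corollary — an up step before a down step leaves the four crossing words.** At slack four (`m = 6k + 4`, `k ≥ 2`),
for an irreducible positive wall bridge with `k` visits and four down steps, if some up time precedes some down time then
`r₁ < p₄` and the word is `D D D U D U U U`, `D D D U U D U U`, `D D U D D U U U` or `D D U U D D U U` (the alternative of
`four_down_slack_four` minus the non-crossing word `D D D D U U U U`).  Four-down analogue of
`eq_g3b_of_three_down_of_up_lt_down` (`…SlackFourThreeDown`).  OURS.
[cite: MadrasSlade1993, §4.2, Definition 4.2.1 (p. 90); EntingJensen2009, §7.4.2, Fig. 7.10] -/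
theorem up_lt_down_four_down_slack_four {k m : ℕ} (hk : 2 ≤ k) (hm : m = 6 * k + 4) (hω : ω ∈ ipwb m)
    (hv : visits m ω = k) (hcD : #(stepsD m ω) = 4) {r p : ℕ} (hr : r ∈ stepsU m ω) (hp : p ∈ stepsD m ω)
    (hrp : r < p) :
    ∃ p₁ p₂ p₃ p₄ r₁ r₂ r₃ r₄, stepsD m ω = {p₁, p₂, p₃, p₄} ∧ stepsU m ω = {r₁, r₂, r₃, r₄} ∧ p₁ < p₂ ∧ p₂ < p₃ ∧
      p₃ < p₄ ∧ r₁ < r₂ ∧ r₂ < r₃ ∧ r₃ < r₄ ∧ r₁ < p₄ ∧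
      ((p₃ < r₁ ∧ p₄ < r₂) ∨ (p₃ < r₁ ∧ r₂ < p₄ ∧ p₄ < r₃) ∨ (p₂ < r₁ ∧ r₁ < p₃ ∧ p₄ < r₂) ∨
        (p₂ < r₁ ∧ r₂ < p₃ ∧ p₄ < r₃)) := by
  classical
  obtain ⟨p₁, p₂, p₃, p₄, r₁, r₂, r₃, r₄, hD, hU, h12, h23, h34, hr12, hr23, hr34, -, -, -, -, -, -, -, -, -, -, halt⟩ :=
    four_down_slack_four hk hm hω hv hcD
  refine ⟨p₁, p₂, p₃, p₄, r₁, r₂, r₃, r₄, hD, hU, h12, h23, h34, hr12, hr23, hr34, ?_⟩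
  rw [hD] at hp
  rw [hU] at hr
  simp only [Finset.mem_insert, Finset.mem_singleton] at hp hr
  rcases halt with h41 | ⟨h31, h41, h42⟩ | ⟨h31, h42, h43⟩ | ⟨h21, h31, h42⟩ | ⟨h21, h32, h43⟩
  · exfalso; omega
  · exact ⟨h41, Or.inl ⟨h31, h42⟩⟩
  · exact ⟨by omega, Or.inr (Or.inl ⟨h31, h42, h43⟩)⟩
  · exact ⟨by omega, Or.inr (Or.inr (Or.inl ⟨h21, h31, h42⟩))⟩
  · exact ⟨by omega, Or.inr (Or.inr (Or.inr ⟨h21, h32, h43⟩))⟩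

end Literature.Probability.RandomPlanarGeometry.SAW.HexBW.Wall
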